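import Summits.CriticalPhenomena.PercolationContinuityZ3.Theorems.Transplant.HexShadowGammaMin
import HarnessLib

/-!
# HEXAGONAL SHADOWS XXIV — towards Fact 2 of DST §2.3 on a general graph: the structure is invisible from the old world (propagation lemma)

builds on p205010 (kernel theorem, internal audit signed; external expert review pending) — NOT used in this file.  Lane `prim-bschramm`, seat
`prim-bschramm-p2` (gen 32; class C1b; memo §117); helper file (`--supports stmt-CriticalPhenomena-4575 --as helper`).  Slab original:
`Literature/…/SlabGluingRecovery` (`not_mem_structure_of_pathIn`, `not_mem_structure_of_openConnIn`), VERBATIM for an arbitrary vertex type (primed names, the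
slab versions being in scope).  If `ω' ⊆ ω ∪ Enew` with every new edge joining structure vertices `Sw`, protected vertices `Wv ⊆ Sw` entered by open edges
only from the structure or when in `Keep`, and unprotected structure vertices not `ω`-joined inside `Reg` to `x₀`, then along any `ω'`-open path inside
`A ⊆ Reg` with `A ∩ Keep ∩ Sw = ∅` the property "off the structure and `ω`-joined to `x₀` inside `Reg`" propagates (DST's recovery step "`z` is the only
vertex in `γ_min(ω^{(z)})` which is connected to `S'_n` in `B'_n ∖ γ_min(ω^{(z)})`", p. 7).
[cite: DuminilCopinSidoraviciusTassion2016, §2.3 (proof of Fact 2, p. 7)]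
-/

noncomputable section

namespace Summit.CriticalPhenomena.PercolationContinuityZ3.Theorems.Transplant

open MeasureTheory Literature.Probability.Percolation Literature.Probability.LatticeModels SimpleGraph Filter
open scoped Classical Topology

variable {V : Type}

/-- PROVED — **propagation off the structure** (DST 2016, §2.3, proof of Fact 2, recovery step).
Along an `ω'`-open path inside `A ⊆ Reg`, if the start is off the structure `Sw` and `ω`-joined
to `x₀` inside `Reg`, so is the end — provided new edges join structure vertices (`hEnew`),
protected vertices are entered only from the structure or lie in `Keep` (`h2`), `A` contains no
structure vertex of `Keep` (`hA`), and unprotected structure vertices are not `ω`-joined to `x₀`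
inside `Reg` (`h4`). [cite: DuminilCopinSidoraviciusTassion2016, §2.3, proof of Fact 2 (p. 7)] -/
theorem not_mem_structure_of_pathIn' {ω ω' : BondConfig V} {Reg A : Set V}
    (hAReg : A ⊆ Reg) (Enew : Set (Sym2 V)) (Wv Sw Keep : Set V)
    (hWv : Wv ⊆ Sw) (x₀ : V)
    (h3 : ω' ⊆ ω ∪ Enew) (hEnew : ∀ a b, s(a, b) ∈ Enew → a ∈ Sw ∧ b ∈ Sw)
    (h2 : ∀ t x, s(t, x) ∈ ω' → x ∈ Wv → t ∈ Sw ∨ x ∈ Keep)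
    (hA : ∀ x ∈ A, x ∈ Keep → x ∉ Sw)
    (h4 : ∀ x ∈ Sw, x ∉ Wv → ω ∉ openConnIn Reg x₀ x)
    {q s : V} (hpath : PathIn (openGraph ω') A q s)
    (hq : q ∉ Sw) (hq' : ω ∈ openConnIn Reg x₀ q) :
    s ∉ Sw ∧ ω ∈ openConnIn Reg x₀ s := by
  obtain ⟨-, h⟩ := hpath
  induction h with
  | refl => exact ⟨hq, hq'⟩
  | @tail y y' _ hyy' ih =>
    obtain ⟨hy, hy'⟩ := ih
    obtain ⟨hadj, hy'A⟩ := hyy'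
    have he : s(y, y') ∈ ω' ∧ y ≠ y' := (openGraph_adj ω' y y').1 hadj
    have hω : s(y, y') ∈ ω := by
      rcases h3 he.1 with h | h
      · exact h
      · exact absurd (hEnew _ _ h).1 hy
    have hyReg : y ∈ Reg := hy'.2.1
    have hy'Reg : y' ∈ Reg := hAReg hy'A
    have hconn : ω ∈ openConnIn Reg x₀ y' := by
      refine SlabCriticality.openConnIn_trans hy' ?_
      exact openConnIn_head_of_mem_chain y [y']
        (List.isChain_cons_cons.2 ⟨⟨hω, he.2⟩, List.isChain_singleton _⟩)
        (fun v hv => by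
          simp only [List.mem_cons, List.not_mem_nil, or_false] at hv
          rcases hv with rfl | rfl
          · exact hyReg
          · exact hy'Reg) y' (by simp)
    have hy'W : y' ∉ Wv := fun hW => by
      rcases h2 y y' he.1 hW with h | h
      · exact hy h
      · exact hA y' hy'A h (hWv hW)
    exact ⟨fun hS => h4 y' hS hy'W hconn, hconn⟩

/-- Corollary in `openConnIn` form. [cite: DuminilCopinSidoraviciusTassion2016, §2.3, proof of
Fact 2 (p. 7)] -/
theorem not_mem_structure_of_openConnIn' {ω ω' : BondConfig V} {Reg A : Set V}
    (hAReg : A ⊆ Reg) (Enew : Set (Sym2 V)) (Wv Sw Keep : Set V)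
    (hWv : Wv ⊆ Sw) (x₀ : V)
    (h3 : ω' ⊆ ω ∪ Enew) (hEnew : ∀ a b, s(a, b) ∈ Enew → a ∈ Sw ∧ b ∈ Sw)
    (h2 : ∀ t x, s(t, x) ∈ ω' → x ∈ Wv → t ∈ Sw ∨ x ∈ Keep)
    (hA : ∀ x ∈ A, x ∈ Keep → x ∉ Sw)
    (h4 : ∀ x ∈ Sw, x ∉ Wv → ω ∉ openConnIn Reg x₀ x)
    {q s : V} (hqs : ω' ∈ openConnIn A q s)
    (hq : q ∉ Sw) (hq' : ω ∈ openConnIn Reg x₀ q) :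
    s ∉ Sw ∧ ω ∈ openConnIn Reg x₀ s :=
  not_mem_structure_of_pathIn' hAReg Enew Wv Sw Keep hWv x₀ h3 hEnew h2 hA h4
    (mem_openConnIn_iff_pathIn.1 hqs) hq hq'

end Summit.CriticalPhenomena.PercolationContinuityZ3.Theorems.Transplant

end
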